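import Summits.CriticalPhenomena.PercolationContinuityZ3.Theorems.SahiAESeparableTilt
import Summits.CriticalPhenomena.PercolationContinuityZ3.Theorems.SahiAECornerEnvelopePos

/-!
# Uniformly positive Borel everywhere-MTP₂ versions, and the additive form: Borel everywhere-SUPERMODULAR versions

Support file of the Sahi cell (`prim-sahi`, typer seat, generation 21; `--supports stmt-CriticalPhenomena-4575`).
Theorems only (no definitions, no named facts, no sorries).

`SahiAESeparableTilt.exists_measurable_mtp2_version_of_ae_of_pos` (lit g35) gives a bounded Borel everywhere-MTP₂
version of an a.e.-MTP₂ density `f : ℝ^ι → [c, M]` (Lebesgue reference), recording only an upper bound.  Running the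
same assembly with the envelope's lower bound (`exists_measurable_mtp2_version_of_ae_monotone_pos`) and the bounds
implicit in the separable tilt (`f = g · ∏ᵢ uᵢ(xᵢ)`, `uᵢ ≤ M'`, `g ≤ M'`, hence `∏ᵢ uᵢ(xᵢ) ≥ c / M'` and
`g ≥ c / M'^{|ι|}`) gives a version with TWO-SIDED bounds `0 < c' ≤ F ≤ M' < ∞`:

* `exists_pos_measurable_mtp2_version_of_ae` (Lebesgue), `exists_pos_measurable_mtp2_version_of_ae_of_equivalent`
  (any s-finite reference measure equivalent to Lebesgue), `…_withDensity_volume` (a.e.-positive densities);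
* **the additive corollary** `exists_measurable_supermodular_version_of_ae`: a bounded measurable `φ : ℝ^ι → ℝ`
  which is SUPERMODULAR on Lebesgue-almost every pair, `φ(x) + φ(y) ≤ φ(x ∧ y) + φ(x ∨ y)`, has a bounded Borel
  version supermodular at EVERY pair (`ψ = log F` for a positive version `F` of `e^φ`); likewise under any s-finite
  measure equivalent to Lebesgue (`…_of_equivalent`).

Scope: product reference measures with atoms / not equivalent to Lebesgue are NOT treated here (the transported
versions of `SahiAEVersionTransport*` vanish outside a full-measure sublattice).  No sorries, no new axioms.
-/

noncomputable section

namespace Summit.CriticalPhenomena.PercolationContinuityZ3.Theorems.SahiAEFourFunctions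

open MeasureTheory Set Filter Topology
open Summit.CriticalPhenomena.PercolationContinuityZ3.Theorems.SahiAESeparableTilt
open scoped ENNReal NNReal

variable {ι : Type*} [Fintype ι]

/-! ### Uniformly positive versions (Lebesgue) -/

/-- **A Borel everywhere-MTP₂ version with two-sided bounds.**  A measurable `f : ℝ^ι → [c, M]` (`0 < c`, `M < ∞`)
which is MTP₂ on Lebesgue-almost every pair has a Borel version `F`, `0 < c' ≤ F ≤ M' < ∞`, `F = f` a.e.,
`F(x) F(y) ≤ F(x ∧ y) F(x ∨ y)` at EVERY pair. [this work] -/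
theorem exists_pos_measurable_mtp2_version_of_ae (f : (ι → ℝ) → ℝ≥0∞) (hf : Measurable f) {c M : ℝ≥0∞}
    (hc : c ≠ 0) (hM : M ≠ ∞) (hcf : ∀ x, c ≤ f x) (hfM : ∀ x, f x ≤ M)
    (hMTP : ∀ᵐ p ∂(volume : Measure (ι → ℝ)).prod volume, f p.1 * f p.2 ≤ f (p.1 ⊓ p.2) * f (p.1 ⊔ p.2)) :
    ∃ F : (ι → ℝ) → ℝ≥0∞, Measurable F ∧ (∃ c' M' : ℝ≥0∞, c' ≠ 0 ∧ M' ≠ ∞ ∧ ∀ x, c' ≤ F x ∧ F x ≤ M') ∧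
      F =ᵐ[volume] f ∧ ∀ x y, F x * F y ≤ F (x ⊓ y) * F (x ⊔ y) := by
  classical
  obtain ⟨u, g, M', hum, hu, hgm, hM', hgM', hfg, hgMTP, hgmono⟩ :=
    exists_separable_tilt_mtp2 f hf hc hM hcf hfM hMTP
  -- bounds implicit in the factorisation
  have hprod_le : ∀ x : ι → ℝ, ∏ i, u i (x i) ≤ M' ^ Fintype.card ι := fun x => by
    have h := Finset.prod_le_pow_card Finset.univ (fun i => u i (x i)) M' fun i _ => (hu i (x i)).2
    simpa only [Finset.card_univ] using h
  have hpowT : M' ^ Fintype.card ι ≠ ∞ := ENNReal.pow_ne_top hM'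
  have hg_ge : ∀ x : ι → ℝ, c / M' ^ Fintype.card ι ≤ g x := fun x =>
    ENNReal.div_le_of_le_mul (((hcf x).trans_eq (hfg x)).trans (mul_le_mul_right (hprod_le x) _))
  have hprod_ge : ∀ x : ι → ℝ, c / M' ≤ ∏ i, u i (x i) := fun x => by
    refine ENNReal.div_le_of_le_mul (((hcf x).trans_eq (hfg x)).trans ?_)
    rw [mul_comm]
    exact mul_le_mul_right (hgM' x) _
  have hc₀ : c / M' ^ Fintype.card ι ≠ 0 := (ENNReal.div_pos_iff.2 ⟨hc, hpowT⟩).ne'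
  have hc₁ : c / M' ≠ 0 := (ENNReal.div_pos_iff.2 ⟨hc, hM'⟩).ne'
  obtain ⟨F₀, hF₀m, hF₀b, hF₀g, hF₀mtp⟩ :=
    exists_measurable_mtp2_version_of_ae_monotone_pos g hgm hM' hg_ge hgM' hgMTP hgmono
  refine ⟨fun x => F₀ x * ∏ i, u i (x i), ?_, ⟨c / M' ^ Fintype.card ι * (c / M'), M' * M' ^ Fintype.card ι,
    mul_ne_zero hc₀ hc₁, ENNReal.mul_ne_top hM' hpowT, fun x => ⟨?_, ?_⟩⟩, ?_, ?_⟩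
  · exact hF₀m.mul (Finset.measurable_prod _ fun i _ => (hum i).comp (measurable_pi_apply i))
  · exact mul_le_mul' (hF₀b x).1 (hprod_ge x)
  · exact mul_le_mul' (hF₀b x).2 (hprod_le x)
  · filter_upwards [hF₀g] with x hx
    show F₀ x * ∏ i, u i (x i) = f x
    rw [hx, hfg x]
  · intro x y
    calc F₀ x * (∏ i, u i (x i)) * (F₀ y * ∏ i, u i (y i))
        = F₀ x * F₀ y * ((∏ i, u i (x i)) * ∏ i, u i (y i)) := mul_mul_mul_comm _ _ _ _
      _ ≤ F₀ (x ⊓ y) * F₀ (x ⊔ y) * ((∏ i, u i ((x ⊓ y) i)) * ∏ i, u i ((x ⊔ y) i)) :=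
          mul_le_mul' (hF₀mtp x y) (prod_mul_prod_eq_inf_sup u x y).le
      _ = F₀ (x ⊓ y) * (∏ i, u i ((x ⊓ y) i)) * (F₀ (x ⊔ y) * ∏ i, u i ((x ⊔ y) i)) :=
          (mul_mul_mul_comm _ _ _ _).symm

/-- **Two-sided bounded versions under any s-finite reference measure equivalent to Lebesgue** (e.g. a law with an
a.e.-positive density). [this work] -/
theorem exists_pos_measurable_mtp2_version_of_ae_of_equivalent (μ : Measure (ι → ℝ)) [SFinite μ]
    (h₁ : μ ≪ volume) (h₂ : (volume : Measure (ι → ℝ)) ≪ μ) (f : (ι → ℝ) → ℝ≥0∞) (hf : Measurable f)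
    {c M : ℝ≥0∞} (hc : c ≠ 0) (hM : M ≠ ∞) (hcf : ∀ x, c ≤ f x) (hfM : ∀ x, f x ≤ M)
    (hMTP : ∀ᵐ p ∂μ.prod μ, f p.1 * f p.2 ≤ f (p.1 ⊓ p.2) * f (p.1 ⊔ p.2)) :
    ∃ F : (ι → ℝ) → ℝ≥0∞, Measurable F ∧ (∃ c' M' : ℝ≥0∞, c' ≠ 0 ∧ M' ≠ ∞ ∧ ∀ x, c' ≤ F x ∧ F x ≤ M') ∧
      F =ᵐ[μ] f ∧ ∀ x y, F x * F y ≤ F (x ⊓ y) * F (x ⊔ y) := by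
  obtain ⟨F, hFm, hFb, hFf, hFmtp⟩ :=
    exists_pos_measurable_mtp2_version_of_ae f hf hc hM hcf hfM ((h₂.prod h₂).ae_le hMTP)
  exact ⟨F, hFm, hFb, h₁.ae_le hFf, hFmtp⟩

/-- In particular for `volume.withDensity h`, `h` measurable and a.e. positive. [this work] -/
theorem exists_pos_measurable_mtp2_version_of_ae_withDensity_volume {h : (ι → ℝ) → ℝ≥0∞} (hh : Measurable h)
    (h0 : ∀ᵐ x ∂(volume : Measure (ι → ℝ)), h x ≠ 0) (f : (ι → ℝ) → ℝ≥0∞) (hf : Measurable f)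
    {c M : ℝ≥0∞} (hc : c ≠ 0) (hM : M ≠ ∞) (hcf : ∀ x, c ≤ f x) (hfM : ∀ x, f x ≤ M)
    (hMTP : ∀ᵐ p ∂((volume : Measure (ι → ℝ)).withDensity h).prod ((volume : Measure (ι → ℝ)).withDensity h),
      f p.1 * f p.2 ≤ f (p.1 ⊓ p.2) * f (p.1 ⊔ p.2)) :
    ∃ F : (ι → ℝ) → ℝ≥0∞, Measurable F ∧ (∃ c' M' : ℝ≥0∞, c' ≠ 0 ∧ M' ≠ ∞ ∧ ∀ x, c' ≤ F x ∧ F x ≤ M') ∧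
      F =ᵐ[(volume : Measure (ι → ℝ)).withDensity h] f ∧ ∀ x y, F x * F y ≤ F (x ⊓ y) * F (x ⊔ y) :=
  exists_pos_measurable_mtp2_version_of_ae_of_equivalent _ (withDensity_absolutelyContinuous _ _)
    (withDensity_absolutelyContinuous' hh.aemeasurable h0) f hf hc hM hcf hfM hMTP

/-! ### The additive form: Borel everywhere-supermodular versions -/

/-- **A bounded measurable function which is supermodular on almost every pair has a bounded Borel version which is
supermodular at every pair** (any s-finite reference measure `μ` equivalent to Lebesgue measure on `ℝ^ι`, e.g. Lebesgue
itself): `|φ| ≤ K`, `φ(x) + φ(y) ≤ φ(x ∧ y) + φ(x ∨ y)` for `μ ⊗ μ`-a.e. `(x, y)` ⟹ `∃ ψ` Borel, bounded, `ψ = φ` `μ`-a.e.,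
`ψ(x) + ψ(y) ≤ ψ(x ∧ y) + ψ(x ∨ y)` for ALL `x, y`.  Proof: `ψ = log F` for a two-sided-bounded everywhere-MTP₂ version
`F` of `e^φ`. [this work] -/
theorem exists_measurable_supermodular_version_of_ae_of_equivalent (μ : Measure (ι → ℝ)) [SFinite μ]
    (h₁ : μ ≪ volume) (h₂ : (volume : Measure (ι → ℝ)) ≪ μ) (φ : (ι → ℝ) → ℝ) (hφ : Measurable φ) {K : ℝ}
    (hK : ∀ x, |φ x| ≤ K)
    (hsm : ∀ᵐ p ∂μ.prod μ, φ p.1 + φ p.2 ≤ φ (p.1 ⊓ p.2) + φ (p.1 ⊔ p.2)) :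
    ∃ ψ : (ι → ℝ) → ℝ, Measurable ψ ∧ (∃ K' : ℝ, ∀ x, |ψ x| ≤ K') ∧ ψ =ᵐ[μ] φ ∧
      ∀ x y, ψ x + ψ y ≤ ψ (x ⊓ y) + ψ (x ⊔ y) := by
  -- the multiplicative density `f = e^φ`
  set f : (ι → ℝ) → ℝ≥0∞ := fun x => ENNReal.ofReal (Real.exp (φ x)) with hfdef
  have hfm : Measurable f := ENNReal.measurable_ofReal.comp (Real.measurable_exp.comp hφ)
  have hc : ENNReal.ofReal (Real.exp (-K)) ≠ 0 := (ENNReal.ofReal_pos.2 (Real.exp_pos _)).ne'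
  have hcf : ∀ x, ENNReal.ofReal (Real.exp (-K)) ≤ f x := fun x =>
    ENNReal.ofReal_le_ofReal (Real.exp_le_exp.2 (abs_le.1 (hK x)).1)
  have hfM : ∀ x, f x ≤ ENNReal.ofReal (Real.exp K) := fun x =>
    ENNReal.ofReal_le_ofReal (Real.exp_le_exp.2 (abs_le.1 (hK x)).2)
  have hMTP : ∀ᵐ p ∂μ.prod μ, f p.1 * f p.2 ≤ f (p.1 ⊓ p.2) * f (p.1 ⊔ p.2) := by
    filter_upwards [hsm] with p hp
    simp only [hfdef]
    rw [← ENNReal.ofReal_mul (Real.exp_pos _).le, ← ENNReal.ofReal_mul (Real.exp_pos _).le, ← Real.exp_add,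
      ← Real.exp_add]
    exact ENNReal.ofReal_le_ofReal (Real.exp_le_exp.2 hp)
  obtain ⟨F, hFm, ⟨c', M', hc', hM', hFb⟩, hFf, hFmtp⟩ :=
    exists_pos_measurable_mtp2_version_of_ae_of_equivalent μ h₁ h₂ f hfm hc ENNReal.ofReal_ne_top hcf hfM hMTP
  have hc'T : c' ≠ ∞ := ne_top_of_le_ne_top hM' ((hFb fun _ => 0).1.trans (hFb fun _ => 0).2)
  have hFT : ∀ x, F x ≠ ∞ := fun x => ne_top_of_le_ne_top hM' (hFb x).2
  have hF0 : ∀ x, F x ≠ 0 := fun x => (lt_of_lt_of_le (pos_iff_ne_zero.2 hc') (hFb x).1).ne'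
  have hFpos : ∀ x, 0 < (F x).toReal := fun x => ENNReal.toReal_pos (hF0 x) (hFT x)
  refine ⟨fun x => Real.log (F x).toReal, Real.measurable_log.comp (ENNReal.measurable_toReal.comp hFm),
    ⟨max |Real.log c'.toReal| |Real.log M'.toReal|, fun x => ?_⟩, ?_, fun x y => ?_⟩
  · -- bounded
    have h1 : Real.log c'.toReal ≤ Real.log (F x).toReal :=
      Real.log_le_log (ENNReal.toReal_pos hc' hc'T) (ENNReal.toReal_mono (hFT x) (hFb x).1)
    have h2 : Real.log (F x).toReal ≤ Real.log M'.toReal :=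
      Real.log_le_log (hFpos x) (ENNReal.toReal_mono hM' (hFb x).2)
    have h3 : -(max |Real.log c'.toReal| |Real.log M'.toReal|) ≤ Real.log c'.toReal := by
      have ha := neg_abs_le (Real.log c'.toReal)
      have hb := le_max_left |Real.log c'.toReal| |Real.log M'.toReal|
      linarith
    exact abs_le.2 ⟨h3.trans h1, h2.trans (le_max_of_le_right (le_abs_self _))⟩
  · -- `ψ = φ` a.e.
    filter_upwards [hFf] with x hx
    show Real.log (F x).toReal = φ x
    rw [hx, hfdef, ENNReal.toReal_ofReal (Real.exp_pos _).le, Real.log_exp]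
  · -- supermodular at every pair
    have h := hFmtp x y
    have hL : (F x * F y).toReal ≤ (F (x ⊓ y) * F (x ⊔ y)).toReal :=
      ENNReal.toReal_mono (ENNReal.mul_ne_top (hFT _) (hFT _)) h
    rw [ENNReal.toReal_mul, ENNReal.toReal_mul] at hL
    rw [← Real.log_mul (hFpos x).ne' (hFpos y).ne', ← Real.log_mul (hFpos _).ne' (hFpos _).ne']
    exact Real.log_le_log (mul_pos (hFpos x) (hFpos y)) hL

/-- **Lebesgue reference measure**: a bounded measurable `φ : ℝ^ι → ℝ` supermodular on `λ ⊗ λ`-almost every pair has a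
bounded Borel version supermodular at every pair. [this work] -/
theorem exists_measurable_supermodular_version_of_ae (φ : (ι → ℝ) → ℝ) (hφ : Measurable φ) {K : ℝ}
    (hK : ∀ x, |φ x| ≤ K)
    (hsm : ∀ᵐ p ∂(volume : Measure (ι → ℝ)).prod volume, φ p.1 + φ p.2 ≤ φ (p.1 ⊓ p.2) + φ (p.1 ⊔ p.2)) :
    ∃ ψ : (ι → ℝ) → ℝ, Measurable ψ ∧ (∃ K' : ℝ, ∀ x, |ψ x| ≤ K') ∧ ψ =ᵐ[volume] φ ∧
      ∀ x y, ψ x + ψ y ≤ ψ (x ⊓ y) + ψ (x ⊔ y) :=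
  exists_measurable_supermodular_version_of_ae_of_equivalent volume Measure.AbsolutelyContinuous.rfl
    Measure.AbsolutelyContinuous.rfl φ hφ hK hsm

end Summit.CriticalPhenomena.PercolationContinuityZ3.Theorems.SahiAEFourFunctions
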